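import Literature.NumberTheory.EllipticCurves.BhargavaHo2022.LargeFamilyEulerProduct
import HarnessLib

/-!
# BirchSwinnertonDyer / CountingDoorF2AtThree — cruxes I1/I2 (stmt-BirchSwinnertonDyer-19440/19441),
# lane «closed-form root numbers + squarefree sieve»: SPLITTING A FINITELY-CONDITIONED FAMILY INTO
# RESIDUE CLASSES (route-free, fact-free combinatorics over Bhargava–Ho's `CongruenceFamily₂`)

The sieve reductions of `route-BirchSwinnertonDyer-CountingDoorF2AtThree` (files
`CountingDoorF2AtThreeSelmerAverageSieve.lean`, `CountingDoorF2AtThreeRootNumberSieve.lean`, and the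
lane's `…SieveTail` companions discharging the squarefree-sieve tail from Bhargava–Ho's Thm. 9.1 with
its constant, `thm9_1_F2_eulerProduct.tail_estimate`) reduce an `AverageOnLE` input on every LARGE
subfamily of `F₂` to the same input on every subfamily `Ψ` with FINITELY many congruence conditions
(no condition at the primes `p ≥ Y`). The currency in which an analytic input would actually be
proved is one step more primitive: single RESIDUE CLASSES `{a ≡ r (mod N)}` in height boxes, i.e.
finitely-conditioned families whose local condition at each conditioned prime is ONE residue class.
This ROUTE-FREE file supplies that last step, for an arbitrary invariant `f` and bound `θ`:

* `averageOnLE_of_finite_cover` — if `Ψ` is covered DISJOINTLY by finitely many subfamilies `Φ i`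
  (`Ψ.Mem a ↔ ∃ i ∈ S, (Φ i).Mem a`, membership in two of them forces `i = j`), `Ψ(<X)` is eventually
  nonempty, and each `Φ i` satisfies `AverageOnLE f θ`, then so does `Ψ` (an average over a disjoint
  union is a convex combination of the averages);
* `mem_pinAt_iff`, `averageOnLE_of_pinAt` — pinning the residue at ONE prime `q`: `Ψ` is the
  disjoint union over `ρ ∈ Ψ.residues q` (a finite set) of the families `Ψ[q ↦ ρ]`;
* `averageOnLE_of_classes` — by induction on the number of conditioned primes with more than one
  allowed residue: if every finitely-conditioned family with nonempty local conditions ALL OF WHICH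
  ARE SINGLE CLASSES OR TRIVIAL (`residues p` a subsingleton or `univ`) satisfies `AverageOnLE f θ`,
  then every finitely-conditioned family with nonempty local conditions and eventually nonempty
  height balls does.

Nothing is asserted; no fact is used (the Euler-product file is imported only for the vocabulary and
for the consumers' convenience). PARTITION: none — r_an ≥ 2, summit axis S0; TWIN (D-0056): n/a. B1
honesty: finite combinatorics of congruence families; no curve invariant is mentioned.

References: M. Bhargava, W. Ho, arXiv:2207.03309 (2022) §1 (subfamilies defined by congruence
conditions), §9.1 [BhargavaHo2022]; M. Bhargava, A. Shankar, Ann. of Math. 181 (2015) §2.7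
[BhargavaShankarAnnals2015].
-/

set_option linter.dupNamespace false

noncomputable section

open scoped Classical
open Filter Topology Finset
open Literature.NumberTheory.EllipticCurves.BhargavaHo2022

namespace Summit.BirchSwinnertonDyer.BirchSwinnertonDyer.Theorems

namespace F2ClassSplitting

/-! ### §1 Averages over a finite disjoint cover -/

/-- **An average over a finite disjoint union is a convex combination.** Let the subfamily `Ψ ⊆ F₂` be
covered disjointly by the subfamilies `Φ i`, `i ∈ S` (`S` finite), let `Ψ(<X)` be eventually nonempty,
and let every `Φ i` satisfy `AverageOnLE f θ`. Then `Ψ.AverageOnLE f θ`. [folklore] -/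
theorem averageOnLE_of_finite_cover {ι : Type*} (S : Finset ι) (Φ : ι → CongruenceFamily₂)
    (Ψ : CongruenceFamily₂) {f : Params → ℝ} {θ : ℝ}
    (hcover : ∀ a : Params, Ψ.Mem a ↔ ∃ i ∈ S, (Φ i).Mem a)
    (hdisj : ∀ (a : Params) (i j : ι), i ∈ S → j ∈ S → (Φ i).Mem a → (Φ j).Mem a → i = j)
    (hne : ∀ᶠ X : ℕ in atTop, 0 < (Ψ.below X).card)
    (h : ∀ i ∈ S, (Φ i).AverageOnLE f θ) :
    Ψ.AverageOnLE f θ := by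
  intro ε hε
  -- eventually, every piece has `Σ f ≤ (θ + ε) · #piece`
  have hev : ∀ᶠ X : ℕ in atTop, ∀ i ∈ S,
      ∑ a ∈ (Φ i).below X, f a ≤ (θ + ε) * ((Φ i).below X).card := by
    refine (Finset.eventually_all S).2 fun i hi ↦ ?_
    filter_upwards [h i hi ε hε] with X hX
    unfold CongruenceFamily₂.averageOn at hX
    rcases Nat.eq_zero_or_pos ((Φ i).below X).card with h0 | hpos
    · rw [Finset.card_eq_zero.mp h0, Finset.sum_empty, Finset.card_empty, Nat.cast_zero, mul_zero]
    · rwa [div_le_iff₀ (by exact_mod_cast hpos)] at hX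
  filter_upwards [hev, hne] with X hX hXne
  -- `Ψ(<X)` is the disjoint union of the `Φ i (<X)`
  have hU : Ψ.below X = S.biUnion fun i ↦ (Φ i).below X := by
    ext a
    simp only [Finset.mem_biUnion, CongruenceFamily₂.mem_below_iff, hcover]
    constructor
    · rintro ⟨⟨i, hi, hia⟩, hH⟩
      exact ⟨i, hi, hia, hH⟩
    · rintro ⟨i, hi, hia, hH⟩
      exact ⟨⟨i, hi, hia⟩, hH⟩
  have hPD : (S : Set ι).PairwiseDisjoint fun i ↦ (Φ i).below X := by
    intro i hi j hj hij
    refine Finset.disjoint_left.mpr fun a hai haj ↦ hij ?_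
    rw [CongruenceFamily₂.mem_below_iff] at hai haj
    exact hdisj a i j hi hj hai.1 haj.1
  unfold CongruenceFamily₂.averageOn
  have hcard : (0 : ℝ) < (Ψ.below X).card := by exact_mod_cast hXne
  rw [div_le_iff₀ hcard, hU, Finset.sum_biUnion hPD, Finset.card_biUnion hPD]
  push_cast
  rw [Finset.mul_sum]
  exact Finset.sum_le_sum fun i hi ↦ hX i hi

/-! ### §2 Pinning the residue at one prime -/

/-- Membership in the family `Ψ[q ↦ b]` obtained from `Ψ` by shrinking the local condition at `q` to
the single residue of `b` (intersected with `Ψ`'s): `a ∈ Ψ` and `a ≡ b` modulo `q ^ expt q`. [folklore] -/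
theorem mem_pinAt_iff (Ψ : CongruenceFamily₂) (q : ℕ) (hq : q.Prime) (b a : Params) :
    (⟨Ψ.expt, fun p ↦ if p = q then {x | x = Ψ.residueOf p b ∧ x ∈ Ψ.residues p}
      else Ψ.residues p⟩ : CongruenceFamily₂).Mem a ↔
      Ψ.Mem a ∧ Ψ.residueOf q a = Ψ.residueOf q b := by
  constructor
  · rintro ⟨ha, hres⟩
    have hq' : Ψ.residueOf q a ∈ ({x | x = Ψ.residueOf q b ∧ x ∈ Ψ.residues q} : Set _) := by
      have h := hres q hq
      simp only [if_true] at h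
      exact h
    refine ⟨⟨ha, fun p hp ↦ ?_⟩, hq'.1⟩
    by_cases hpq : p = q
    · subst hpq; exact hq'.2
    · have h := hres p hp
      simp only [hpq, if_false] at h
      exact h
  · rintro ⟨⟨ha, hres⟩, hab⟩
    refine ⟨ha, fun p hp ↦ ?_⟩
    by_cases hpq : p = q
    · subst hpq
      simp only [if_true]
      exact ⟨hab, hres p hp⟩
    · simp only [hpq, if_false]
      exact hres p hp

/-- **Splitting at one prime.** If `Ψ(<X)` is eventually nonempty and, for every parameter `b` whose
residue at the prime `q` is allowed by `Ψ`, the pinned family `Ψ[q ↦ b]` satisfies `AverageOnLE f θ`,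
then `Ψ.AverageOnLE f θ`: `Ψ` is the disjoint union of the `Ψ[q ↦ b_ρ]` over the finitely many
allowed residues `ρ` modulo `q ^ expt q`. [folklore] -/
theorem averageOnLE_of_pinAt (Ψ : CongruenceFamily₂) (q : ℕ) (hq : q.Prime) {f : Params → ℝ}
    {θ : ℝ} (hne : ∀ᶠ X : ℕ in atTop, 0 < (Ψ.below X).card)
    (h : ∀ b : Params, Ψ.residueOf q b ∈ Ψ.residues q →
      (⟨Ψ.expt, fun p ↦ if p = q then {x | x = Ψ.residueOf p b ∧ x ∈ Ψ.residues p}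
        else Ψ.residues p⟩ : CongruenceFamily₂).AverageOnLE f θ) :
    Ψ.AverageOnLE f θ := by
  haveI : NeZero (q ^ Ψ.expt q) := ⟨pow_ne_zero _ hq.ne_zero⟩
  -- the allowed residues at `q`, a finite set, and integer representatives
  set R : Finset (ZMod (q ^ Ψ.expt q) × ZMod (q ^ Ψ.expt q) × ZMod (q ^ Ψ.expt q) ×
      ZMod (q ^ Ψ.expt q)) := (Ψ.residues q).toFinite.toFinset with hR
  let rep : (ZMod (q ^ Ψ.expt q) × ZMod (q ^ Ψ.expt q) × ZMod (q ^ Ψ.expt q) ×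
      ZMod (q ^ Ψ.expt q)) → Params := fun ρ ↦
    ⟨(ρ.1.val : ℤ), (ρ.2.1.val : ℤ), (ρ.2.2.1.val : ℤ), (ρ.2.2.2.val : ℤ)⟩
  have hrep : ∀ ρ, Ψ.residueOf q (rep ρ) = ρ := fun ρ ↦ by
    simp only [CongruenceFamily₂.residueOf, rep, Int.cast_natCast, ZMod.natCast_zmod_val]
  let Φ : (ZMod (q ^ Ψ.expt q) × ZMod (q ^ Ψ.expt q) × ZMod (q ^ Ψ.expt q) ×
      ZMod (q ^ Ψ.expt q)) → CongruenceFamily₂ := fun ρ ↦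
    ⟨Ψ.expt, fun p ↦ if p = q then {x | x = Ψ.residueOf p (rep ρ) ∧ x ∈ Ψ.residues p}
      else Ψ.residues p⟩
  have hΦ : ∀ ρ a, (Φ ρ).Mem a ↔ Ψ.Mem a ∧ Ψ.residueOf q a = ρ := fun ρ a ↦ by
    rw [mem_pinAt_iff Ψ q hq (rep ρ) a, hrep]
  refine averageOnLE_of_finite_cover R Φ Ψ (fun a ↦ ?_) (fun a ρ ρ' _ _ ha ha' ↦ ?_) hne
    fun ρ hρ ↦ ?_
  · constructor
    · intro ha
      refine ⟨Ψ.residueOf q a, ?_, (hΦ _ a).mpr ⟨ha, rfl⟩⟩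
      rw [hR, Set.Finite.mem_toFinset]
      exact ha.2 q hq
    · rintro ⟨ρ, -, hρa⟩
      exact ((hΦ ρ a).mp hρa).1
  · rw [← ((hΦ ρ a).mp ha).2, ← ((hΦ ρ' a).mp ha').2]
  · rw [hR, Set.Finite.mem_toFinset] at hρ
    have hb : Ψ.residueOf q (rep ρ) ∈ Ψ.residues q := by rwa [hrep]
    exact h (rep ρ) hb

/-! ### §3 From single residue classes to all finitely-conditioned families -/

/-- **From residue classes to finitely-conditioned families.** Fix an invariant `f` and a bound `θ`.
Suppose every subfamily `Ψ' ⊆ F₂` with finitely many congruence conditions, nonempty local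
conditions, and whose local condition at every prime is a SINGLE CLASS or trivial (`residues p` a
subsingleton or `univ` — i.e. `Ψ' = F₂ ∩ {a ≡ r (mod N)}` for some modulus `N` and class `r`)
satisfies `Ψ'.AverageOnLE f θ`. Then every subfamily `Ψ` with finitely many congruence conditions,
nonempty local conditions and eventually nonempty height balls satisfies `Ψ.AverageOnLE f θ`
(induction on the number of conditioned primes with at least two allowed residues, splitting one
prime at a time by `averageOnLE_of_pinAt`). [folklore] -/
theorem averageOnLE_of_classes {f : Params → ℝ} {θ : ℝ}
    (hclass : ∀ Ψ' : CongruenceFamily₂,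
      (∃ Y : ℕ, ∀ p : ℕ, Y ≤ p → Ψ'.residues p = Set.univ) →
      (∀ p : ℕ, p.Prime → (Ψ'.residues p).Nonempty) →
      (∀ p : ℕ, p.Prime → (Ψ'.residues p).Subsingleton ∨ Ψ'.residues p = Set.univ) →
      Ψ'.AverageOnLE f θ)
    (Ψ : CongruenceFamily₂) (hY : ∃ Y : ℕ, ∀ p : ℕ, Y ≤ p → Ψ.residues p = Set.univ)
    (hne : ∀ p : ℕ, p.Prime → (Ψ.residues p).Nonempty)
    (hballs : ∀ Ψ' : CongruenceFamily₂,
      (∃ Y : ℕ, ∀ p : ℕ, Y ≤ p → Ψ'.residues p = Set.univ) →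
      (∀ p : ℕ, p.Prime → (Ψ'.residues p).Nonempty) → ∀ᶠ X : ℕ in atTop, 0 < (Ψ'.below X).card) :
    Ψ.AverageOnLE f θ := by
  obtain ⟨Y, hY⟩ := hY
  -- induction on the number of "bad" primes below `Y` (at least two allowed residues, not `univ`)
  suffices key : ∀ (n : ℕ) (Ψ : CongruenceFamily₂), (∀ p : ℕ, Y ≤ p → Ψ.residues p = Set.univ) →
      (∀ p : ℕ, p.Prime → (Ψ.residues p).Nonempty) →
      ((Finset.range Y).filter fun p ↦ p.Prime ∧
        ¬ ((Ψ.residues p).Subsingleton ∨ Ψ.residues p = Set.univ)).card ≤ n →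
      Ψ.AverageOnLE f θ from
    key _ Ψ hY hne le_rfl
  intro n
  induction n with
  | zero =>
    intro Ψ hY hne hbad
    refine hclass Ψ ⟨Y, hY⟩ hne fun p hp ↦ ?_
    by_contra hcon
    have hpY : p < Y := by
      by_contra hge
      exact hcon (Or.inr (hY p (not_lt.mp hge)))
    have hmem : p ∈ (Finset.range Y).filter fun p ↦ p.Prime ∧
        ¬ ((Ψ.residues p).Subsingleton ∨ Ψ.residues p = Set.univ) :=
      Finset.mem_filter.mpr ⟨Finset.mem_range.mpr hpY, hp, hcon⟩
    exact absurd (Nat.le_zero.mp hbad) (Finset.card_ne_zero_of_mem hmem)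
  | succ n ih =>
    intro Ψ hY hne hbad
    -- either no bad prime (done by the base case argument) or split at a bad prime `q`
    by_cases hzero : ((Finset.range Y).filter fun p ↦ p.Prime ∧
        ¬ ((Ψ.residues p).Subsingleton ∨ Ψ.residues p = Set.univ)).card = 0
    · refine hclass Ψ ⟨Y, hY⟩ hne fun p hp ↦ ?_
      by_contra hcon
      have hpY : p < Y := by
        by_contra hge
        exact hcon (Or.inr (hY p (not_lt.mp hge)))
      exact Finset.card_ne_zero_of_mem (Finset.mem_filter.mpr ⟨Finset.mem_range.mpr hpY, hp, hcon⟩)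
        hzero
    obtain ⟨q, hq⟩ := Finset.card_pos.mp (Nat.pos_of_ne_zero hzero)
    obtain ⟨hqY, hqP, hqbad⟩ := Finset.mem_filter.mp hq
    refine averageOnLE_of_pinAt Ψ q hqP (hballs Ψ ⟨Y, hY⟩ hne) fun b hb ↦ ?_
    -- the pinned family: same `Y`, nonempty residues, one fewer bad prime
    set Ψb : CongruenceFamily₂ := ⟨Ψ.expt, fun p ↦ if p = q then
      {x | x = Ψ.residueOf p b ∧ x ∈ Ψ.residues p} else Ψ.residues p⟩ with hΨb
    have hres_ne : ∀ p, p ≠ q → Ψb.residues p = Ψ.residues p := fun p hpq ↦ by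
      show (if p = q then {x | x = Ψ.residueOf p b ∧ x ∈ Ψ.residues p} else Ψ.residues p) = _
      rw [if_neg hpq]
    have hres_q : Ψb.residues q = {x | x = Ψ.residueOf q b ∧ x ∈ Ψ.residues q} := by
      show (if q = q then {x | x = Ψ.residueOf q b ∧ x ∈ Ψ.residues q} else Ψ.residues q) = _
      rw [if_pos rfl]
    have hYb : ∀ p : ℕ, Y ≤ p → Ψb.residues p = Set.univ := fun p hp ↦ by
      rw [hres_ne p (by rintro rfl; exact absurd (Finset.mem_range.mp hqY) (not_lt.mpr hp)), hY p hp]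
    have hneb : ∀ p : ℕ, p.Prime → (Ψb.residues p).Nonempty := fun p hp ↦ by
      by_cases hpq : p = q
      · subst hpq
        rw [hres_q]
        exact ⟨Ψ.residueOf p b, rfl, hb⟩
      · rw [hres_ne p hpq]
        exact hne p hp
    refine ih Ψb hYb hneb ?_
    -- the bad set of `Ψb` is contained in that of `Ψ` minus `q`
    have hsub : ((Finset.range Y).filter fun p ↦ p.Prime ∧
        ¬ ((Ψb.residues p).Subsingleton ∨ Ψb.residues p = Set.univ)) ⊆
        ((Finset.range Y).filter fun p ↦ p.Prime ∧
          ¬ ((Ψ.residues p).Subsingleton ∨ Ψ.residues p = Set.univ)).erase q := by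
      intro p hp
      obtain ⟨hpY, hpP, hpbad⟩ := Finset.mem_filter.mp hp
      have hpq : p ≠ q := by
        rintro rfl
        refine hpbad (Or.inl ?_)
        rw [hres_q]
        rintro x ⟨hx, -⟩ y ⟨hy, -⟩
        rw [hx, hy]
      refine Finset.mem_erase.mpr ⟨hpq, Finset.mem_filter.mpr ⟨hpY, hpP, ?_⟩⟩
      rwa [hres_ne p hpq] at hpbad
    have hcard : (((Finset.range Y).filter fun p ↦ p.Prime ∧
        ¬ ((Ψ.residues p).Subsingleton ∨ Ψ.residues p = Set.univ)).erase q).card + 1 =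
        ((Finset.range Y).filter fun p ↦ p.Prime ∧
          ¬ ((Ψ.residues p).Subsingleton ∨ Ψ.residues p = Set.univ)).card :=
      Finset.card_erase_add_one hq
    have := Finset.card_le_card hsub
    omega

end F2ClassSplitting

end Summit.BirchSwinnertonDyer.BirchSwinnertonDyer.Theorems

end
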